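import Literature.NumberTheory.EllipticCurves.HeegnerPointsHeckeOrbitOrdersTransitive
import HarnessLib

/-!
# The adapter `G_ℓ = Gal(K[ℓf]/K[f]) ≃ T_ℓ(x)/Γ₀(N)` for a CM point `x` of conductor `f` on `Y₀(N)`
# (Gross 1991 proof of Prop. 3.7; Nekovář 2007 Prop. (4.8) (i)–(ii)) — no `gcd(N, d_K) = 1`

Topic `NumberTheory/EllipticCurves` (complex multiplication; sequel of
`HeegnerPointsHeckeOrbitOrdersTransitive`), namespace `Literature.NumberTheory.EllipticCurves.HeegnerTraceOrders`.
THEOREMS ONLY: no definition, no named fact (D-0026); unconditional.  First of the two files that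
port `HeegnerTraceRelationProofs.lean` (§§1–3 here, §4 = the trace relation in
`HeegnerTraceRelationOrdersProofs.lean`) from Gross's `heegnerPointOfConductor d_K β m` with
`gcd(N, m d_K) = 1` to a `K[f]`-rational point `x` of `Y₀(N)` (transport form `hfix`; e.g. `x = τ_Q` for
a level-`N` Heegner form of discriminant `f² d_K` with Bezout data) and a Hecke `ℓ`-neighbour
`x' = τ_{Q'}`, `Q'` primitive positive definite of discriminant `(ℓf)² d_K`:

* §1 `#G_ℓ = ℓ + 1` for `G_ℓ = ringClassGalOver ι (ℓf) f` (Galois correspondence + the degree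
  `finrank_subfieldIn_ringClassField_eq_succ`; Nekovář (4.8) (i): `K(x(𝔫ℓ))/K(x(𝔫))` cyclic of degree
  `(Nℓ+1)/u(r)` — here `B = M₂(ℚ)`, `Nℓ = ℓ`, `u(r) = 1` under `f ≥ 2 ∨ d_K < −4`);
* §2 extension of `g ∈ G_ℓ` to `σ_g ∈ Aut(ℂ/K[f])` (`exists_ringEquiv_apply_eq_algEquiv`);
* §3 **`exists_heckeOrbitIndex_bijective_of_fix`** — automorphisms `σ_g` (`σ_g|_{K[f]} = id`,
  `σ_g|_{K[ℓf]} = g`) and a BIJECTION `i : G_ℓ → Option (Fin ℓ)` onto the index set of the `ℓ + 1`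
  standard points `(x + j)/ℓ`, `ℓx` of `T_ℓ(x)` with `LevelTransport N σ_g x' (std (i g))` —
  existence by transitivity (`exists_isHeckeNeighbour_levelTransport_of_fix'`), injectivity by
  `eqOn_ringClassField_of_levelTransport_of_gamma0_smul_eq_of_formJ`, surjectivity by counting.

The private plumbing of `HeegnerTraceRelationProofs` §§1–2 (conductor-independent) is copied verbatim,
being private there.

## References
* B. H. Gross, *Kolyvagin's work on modular elliptic curves*, LMS LNS 153 (1991), §3 Prop. 3.7 (1),
  proof (PDF p. 217 l. 24 – p. 218 l. 1 of `book:editornd-l-functions-arithmetic`). [GrossLMS1991]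
* J. Nekovář, *The Euler system method for CM points on Shimura curves*, LMS LNS 320 (2007),
  Prop. (4.8) (i)–(ii) (PDF p. 0570 L7–15 of `book:burns2007-l-functions-galois-representations`). [Nekovar2007]
* H. Darmon, *Rational points on modular elliptic curves*, CBMS 101 (2004), Prop. 3.10 (proof). [Darmon2004]

## Mathlib / tree search
Tree: `ringClassGalOver`, `ringClassGalOver_le_ringClassGal`, `smul_algebraMap_of_mem_ringClassGal`,
`finiteDimensional_and_isGalois_ringClassField`, `coe_algebraMap_ringClassField`
(`HeegnerPointsOfConductor`); `RingClassField.subfieldIn`, `mem_subfieldIn_iff`,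
`finrank_subfieldIn_ringClassField_eq_succ` (`RingClassFieldTower`); `exists_ringEquiv_apply_eq_algEquiv`
(`RingClassFieldGenerator`); `exists_isHeckeNeighbour_levelTransport_of_fix'`,
`eqOn_ringClassField_of_levelTransport_of_gamma0_smul_eq_of_formJ` (`HeegnerPointsHeckeOrbitOrders*`);
`exists_gamma0_smul_eq_of_isHeckeNeighbour` (`HeckeNeighbourTransport`).
`lean search 'heckeOrbitIndex_bijective'` → only the private original.  presearch: port of tree proofs
([corpus:book:editornd-l-functions-arithmetic p0217–p0218], [corpus:book:burns2007-l-functions-galois-representations p0570]).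
-/

noncomputable section

open scoped Classical MatrixGroups
open Complex UpperHalfPlane CongruenceSubgroup NumberField Module
open Literature.NumberTheory.EllipticCurves.RingClassField
open Literature.NumberTheory.EllipticCurves.ModularForms

namespace Literature.NumberTheory.EllipticCurves

open Literature.NumberTheory.QuadraticFields.BinaryQuadraticForm
  Literature.NumberTheory.QuadraticFields.Quadratic

namespace HeegnerTraceOrders

variable {K : Type} [Field K] [NumberField K]

/-! ## §1 `#G_ℓ = ℓ + 1` for `G_ℓ = Gal(K[ℓf]/K[f]) = ringClassGalOver ι (ℓf) f` -/

/-- An element of `Gal(K[m]/K[m] ∩ K[d]) ≤ Aut_ℚ(K[m])` as a `K`-algebra automorphism of `K[m]`,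
bundled as an injective group homomorphism (copy of the private helper of `HeegnerTraceRelationProofs`).
[folklore] -/
private theorem exists_hom_ringClassGalOver_algEquiv (ι : K →+* ℂ) (m d : ℕ) :
    ∃ τ : ringClassGalOver ι m d →* (ringClassField K ι m ≃ₐ[K] ringClassField K ι m),
      Function.Injective τ ∧
        ∀ g x, τ g x = (g : ringClassField K ι m ≃ₐ[ℚ] ringClassField K ι m) x := by
  have hgK : ∀ g : ringClassGalOver ι m d, ∀ k : K,
      (g : ringClassField K ι m ≃ₐ[ℚ] ringClassField K ι m) (algebraMap K (ringClassField K ι m) k) =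
        algebraMap K (ringClassField K ι m) k := fun g k =>
    smul_algebraMap_of_mem_ringClassGal (ringClassGalOver_le_ringClassGal ι m d g.2) k
  let τ₀ : ringClassGalOver ι m d → (ringClassField K ι m ≃ₐ[K] ringClassField K ι m) := fun g =>
    { (g : ringClassField K ι m ≃ₐ[ℚ] ringClassField K ι m) with commutes' := hgK g }
  have hτ₀ : ∀ g x, τ₀ g x = (g : ringClassField K ι m ≃ₐ[ℚ] ringClassField K ι m) x :=
    fun _ _ => rfl
  refine ⟨{ toFun := τ₀, map_one' := ?_, map_mul' := ?_ }, ?_, hτ₀⟩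
  · ext x; rw [hτ₀]; rfl
  · intro a b; ext x; rw [hτ₀]; rfl
  · intro a b hab
    apply Subtype.ext
    apply AlgEquiv.ext
    intro x
    exact congrArg (fun f : ringClassField K ι m ≃ₐ[K] ringClassField K ι m => f x) hab

/-- **`#Gal(K[n]/K[n] ∩ K[m]) = [K[n] : K[n] ∩ K[m]]`** (Galois correspondence for `K[n]/K`; copy of
the private helper of `HeegnerTraceRelationProofs`).
[cite: GrossLMS1991, §3 (PDF p. 217 l. 1–3: "G_ℓ is the subgroup fixing the subfield K_{n/ℓ}")] -/
private theorem card_ringClassGalOver_eq_finrank_subfieldIn (hK : IsImaginaryQuadratic K) (ι : K →+* ℂ)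
    {n : ℕ} (m : ℕ) (hn : n ≠ 0) :
    Nat.card (ringClassGalOver ι n m) = finrank (subfieldIn ι n m) (ringClassField K ι n) := by
  letI : Algebra K ℂ := ι.toAlgebra
  haveI := (finiteDimensional_and_isGalois_ringClassField hK ι hn).1
  haveI := (finiteDimensional_and_isGalois_ringClassField hK ι hn).2
  obtain ⟨τ, hτinj, hτ⟩ := exists_hom_ringClassGalOver_algEquiv (K := K) ι n m
  have hrange : τ.range = (subfieldIn ι n m).fixingSubgroup := by
    ext σ
    constructor
    · rintro ⟨g, rfl⟩
      rw [IntermediateField.mem_fixingSubgroup_iff]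
      intro x hx
      rw [hτ]
      have hg : ∀ y ∈ {x : ringClassField K ι n | (x : ℂ) ∈ ringClassField K ι m},
          (g : ringClassField K ι n ≃ₐ[ℚ] ringClassField K ι n) • y = y :=
        (_root_.mem_fixingSubgroup_iff
          (M := ringClassField K ι n ≃ₐ[ℚ] ringClassField K ι n)).mp g.2
      exact hg x ((mem_subfieldIn_iff ι n m x).mp hx)
    · intro hσ
      rw [IntermediateField.mem_fixingSubgroup_iff] at hσ
      have hσℚ : ∀ r : ℚ, σ (algebraMap ℚ (ringClassField K ι n) r) =
          algebraMap ℚ (ringClassField K ι n) r := fun r => by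
        rw [eq_ratCast (algebraMap ℚ (ringClassField K ι n)) r, map_ratCast]
      let g : ringClassField K ι n ≃ₐ[ℚ] ringClassField K ι n := { σ with commutes' := hσℚ }
      have hgσ : ∀ x, g x = σ x := fun _ => rfl
      have hg : g ∈ ringClassGalOver ι n m :=
        (_root_.mem_fixingSubgroup_iff
          (M := ringClassField K ι n ≃ₐ[ℚ] ringClassField K ι n)).mpr
          fun y hy => hσ y ((mem_subfieldIn_iff ι n m y).mpr hy)
      refine ⟨⟨g, hg⟩, ?_⟩
      ext x
      rw [hτ]
      exact congrArg (fun z : ringClassField K ι n => (z : ℂ)) (hgσ x)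
  rw [Nat.card_congr (MonoidHom.ofInjective hτinj).toEquiv, hrange]
  exact IsGalois.card_fixingSubgroup_eq_finrank (subfieldIn ι n m)

/-- **`#G_ℓ = ℓ + 1` for `G_ℓ = Gal(K[ℓf]/K[f]) = ringClassGalOver ι (ℓf) f`** (`ℓ` inert, `ℓ ∤ f`,
`f ≥ 1`, `f ≥ 2` or `d_K < −4`; copy of the private helper of `HeegnerTraceRelationProofs`).
[cite: GrossLMS1991, §1, §3 (PDF p. 217 l. 1–3)] [cite: Cox2013, §7.D Thm. 7.24, §9.A] -/
private theorem card_ringClassGalOver_eq_succ (hK : IsImaginaryQuadratic K) (ι : K →+* ℂ) {ℓ f : ℕ}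
    (hℓ : ℓ.Prime) (hinert : (Ideal.span {(ℓ : 𝓞 K)}).IsPrime) (hℓf : ¬ ℓ ∣ f) (hf : f ≠ 0)
    (hunits : 2 ≤ f ∨ NumberField.discr K < -4) :
    Nat.card (ringClassGalOver ι (ℓ * f) f) = ℓ + 1 := by
  rw [card_ringClassGalOver_eq_finrank_subfieldIn hK ι f (mul_ne_zero hℓ.ne_zero hf)]
  exact finrank_subfieldIn_ringClassField_eq_succ hK ι hℓ hinert hℓf hf hunits

/-! ## §2 `Aut_ℚ(K[n])` versus `Aut(ℂ)` -/

/-- An automorphism of `ℂ` fixing `K[m]` pointwise fixes `ι(K) ⊆ K[m]`. [folklore] -/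
private theorem apply_eq_of_forall_mem_ringClassField (ι : K →+* ℂ) {m : ℕ} {σ : ℂ ≃+* ℂ}
    (hσ : ∀ x ∈ ringClassField K ι m, σ x = x) (k : K) : σ (ι k) = ι k :=
  hσ (ι k) (by
    rw [← coe_algebraMap_ringClassField ι m k]
    exact (algebraMap K (ringClassField K ι m) k).2)

/-- **Every `g ∈ Gal(K[n]/K[m])` extends to an automorphism of `ℂ` over `K[m]`** (`m ∣ n`, `n ≥ 1`;
copy of the private helper of `HeegnerTraceRelationProofs`).
[cite: GrossLMS1991, §3 (proof of Prop. 3.7: conjugates of x_n over K_m)] -/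
private theorem exists_ringEquiv_extends_of_mem_ringClassGalOver (hK : IsImaginaryQuadratic K)
    (ι : K →+* ℂ) {m n : ℕ} (hmn : m ∣ n) (hn : n ≠ 0)
    {g : ringClassField K ι n ≃ₐ[ℚ] ringClassField K ι n} (hg : g ∈ ringClassGalOver ι n m) :
    ∃ σ : ℂ ≃+* ℂ, (∀ x ∈ ringClassField K ι m, σ x = x) ∧
      ∀ x : ringClassField K ι n, σ x = ((g x : ringClassField K ι n) : ℂ) := by
  letI : Algebra K ℂ := ι.toAlgebra
  have hg' : ∀ y ∈ {x : ringClassField K ι n | (x : ℂ) ∈ ringClassField K ι m}, g • y = y :=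
    (_root_.mem_fixingSubgroup_iff
      (M := ringClassField K ι n ≃ₐ[ℚ] ringClassField K ι n)).mp hg
  let g' : ringClassField K ι n ≃ₐ[subfieldIn ι n m] ringClassField K ι n :=
    { (g : ringClassField K ι n ≃+* ringClassField K ι n) with
      commutes' := fun r => hg' r.1 ((mem_subfieldIn_iff ι n m r.1).mp r.2) }
  obtain ⟨σ, hσm, hσn⟩ := exists_ringEquiv_apply_eq_algEquiv hK ι hmn hn g'
  exact ⟨σ, hσm, fun x => hσn x⟩

/-! ## §3 The adapter `G_ℓ ≃ T_ℓ(x) / Γ₀(N)` -/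

/-- **The `G_ℓ` adapter for a CM point of conductor `f`** (Gross 1991, proof of Prop. 3.7: "the points
in the divisor `T_ℓ(x_m)` are the conjugates of `x_n` over `K_m`"; Darmon 2004, proof of Prop. 3.10:
"a simply transitive action of `Gal(H_{nℓ}/H_n)`"; Nekovář 2007 (4.8) (iii)).  For `K` imaginary
quadratic, `ι : K → ℂ`, a point `x ∈ ℍ` whose point of `Y₀(N)` is fixed by `Aut(ℂ/K[f])` (`hfix`), a
prime `ℓ` inert in `K` with `ℓ ∤ N`, `ℓ ∤ f`, `f ≥ 1`, `f ≥ 2` or `d_K < −4`, and a Hecke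
`ℓ`-neighbour `x' = τ_{Q'}` of `x` with `Q'` primitive positive definite of discriminant `(ℓf)² d_K`:
there are, for the `g ∈ G_ℓ = ringClassGalOver ι (ℓf) f`, automorphisms `σ_g ∈ Aut(ℂ)` with
`σ_g|_{K[f]} = id`, `σ_g|_{K[ℓf]} = g`, and a BIJECTION `i : G_ℓ → Option (Fin ℓ)` onto the index set
of the `ℓ + 1` standard points of `T_ℓ(x)` (`some j ↦ (x + j)/ℓ`, `none ↦ ℓ·x`) with
`LevelTransport N σ_g x' (std (i g))`.  Twin of the private `exists_heckeOrbitIndex_bijective`.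
[cite: GrossLMS1991, §3 Prop. 3.7 (1) (proof, PDF p. 217 l. 24 – p. 218 l. 1)]
[cite: Nekovar2007, Prop. (4.8) (iii) (p. 0570)] [cite: Darmon2004, Prop. 3.10 (proof)] -/
theorem exists_heckeOrbitIndex_bijective_of_fix (hK : IsImaginaryQuadratic K) (ι : K →+* ℂ)
    {N : ℕ} [NeZero N] {f ℓ : ℕ} (hℓ : ℓ.Prime) (hinert : (Ideal.span {(ℓ : 𝓞 K)}).IsPrime)
    (hℓN : ¬ ℓ ∣ N) (hℓf : ¬ ℓ ∣ f) (hf : f ≠ 0) (hunits : 2 ≤ f ∨ NumberField.discr K < -4)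
    [NeZero ℓ] {x : ℍ}
    (hfix : ∀ σ : ℂ ≃+* ℂ, (∀ z ∈ ringClassField K ι f, σ z = z) → LevelTransport N σ x x)
    {Q' : ℤ × ℤ × ℤ} (hQ'1 : 0 < Q'.1) (hQ'prim : IsPrimitive Q')
    (hQ'disc : discr Q' = ((ℓ * f : ℕ) : ℤ) ^ 2 * NumberField.discr K)
    (hx' : IsHeckeNeighbour N ℓ x (heegnerTau Q')) :
    ∃ (σ : ringClassGalOver ι (ℓ * f) f → (ℂ ≃+* ℂ))
      (i : ringClassGalOver ι (ℓ * f) f → Option (Fin ℓ)),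
      Function.Bijective i ∧
      ∀ g : ringClassGalOver ι (ℓ * f) f,
        (∀ z ∈ ringClassField K ι f, σ g z = z) ∧
        (∀ z : ringClassField K ι (ℓ * f),
          σ g z = (((g : ringClassField K ι (ℓ * f) ≃ₐ[ℚ] ringClassField K ι (ℓ * f)) z :
            ringClassField K ι (ℓ * f)) : ℂ)) ∧
        LevelTransport N (σ g) (heegnerTau Q')
          ((i g).elim (tpD ℓ • x) (fun j => tpB ℓ ((j : ℕ) : ℤ) • x)) := by
  have hn : ℓ * f ≠ 0 := mul_ne_zero hℓ.ne_zero hf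
  have hmn : f ∣ ℓ * f := dvd_mul_left f ℓ
  -- Step 1: extensions `σ_g ∈ Aut(ℂ/K[f])` of the `g ∈ G_ℓ`
  have hext : ∀ g : ringClassGalOver ι (ℓ * f) f, ∃ σ : ℂ ≃+* ℂ,
      (∀ z ∈ ringClassField K ι f, σ z = z) ∧
        ∀ z : ringClassField K ι (ℓ * f),
          σ z = (((g : ringClassField K ι (ℓ * f) ≃ₐ[ℚ] ringClassField K ι (ℓ * f)) z :
            ringClassField K ι (ℓ * f)) : ℂ) :=
    fun g => exists_ringEquiv_extends_of_mem_ringClassGalOver hK ι hmn hn g.2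
  choose σ hσm hσn using hext
  have hσK : ∀ (g : ringClassGalOver ι (ℓ * f) f) (k : K), σ g (ι k) = ι k :=
    fun g => apply_eq_of_forall_mem_ringClassField ι (hσm g)
  -- Step 2: `σ_g` carries `x'` to some Hecke neighbour `τ_g` of `x`
  have hnb : ∀ g : ringClassGalOver ι (ℓ * f) f, ∃ τ' : ℍ,
      IsHeckeNeighbour N ℓ x τ' ∧ LevelTransport N (σ g) (heegnerTau Q') τ' :=
    fun g => exists_isHeckeNeighbour_levelTransport_of_fix' ι hℓ hℓN hfix hx' (hσm g)
  choose τ hτnb hτT using hnb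
  -- Step 3: the `Γ₀(N)`-class of `τ_g` is that of a standard point
  have hidx : ∀ g : ringClassGalOver ι (ℓ * f) f, ∃ (o : Option (Fin ℓ)) (γ : Gamma0 N),
      (γ : SL(2, ℤ)) • τ g = o.elim (tpD ℓ • x) (fun j => tpB ℓ ((j : ℕ) : ℤ) • x) := by
    intro g
    rcases exists_gamma0_smul_eq_of_isHeckeNeighbour hℓ hℓN (hτnb g) with
      ⟨j, hj0, hjℓ, γ, hγ⟩ | ⟨γ, hγ⟩
    · refine ⟨some ⟨j.toNat, (Int.toNat_lt hj0).mpr hjℓ⟩, γ, ?_⟩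
      simp only [Option.elim, Int.toNat_of_nonneg hj0]
      exact hγ
    · exact ⟨none, γ, hγ⟩
  choose i γ hγ using hidx
  refine ⟨σ, i, ?_, fun g => ⟨hσm g, hσn g, (hτT g).of_gamma0_smul_eq_right (hγ g)⟩⟩
  -- injectivity: equal classes force `σ_g = σ_{g'}` on `K[ℓf]`, i.e. `g = g'`
  have hinj : Function.Injective i := by
    intro g g' hgg'
    have h1 : ((γ g : Gamma0 N) : SL(2, ℤ)) • τ g = ((γ g' : Gamma0 N) : SL(2, ℤ)) • τ g' := by
      rw [hγ g, hγ g', hgg']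
    have h2 : (((γ g')⁻¹ * γ g : Gamma0 N) : SL(2, ℤ)) • τ g = τ g' := by
      rw [Subgroup.coe_mul, Subgroup.coe_inv, mul_smul, h1, inv_smul_smul]
    have heq : Set.EqOn (σ g) (σ g') (ringClassField K ι (ℓ * f)) :=
      eqOn_ringClassField_of_levelTransport_of_gamma0_smul_eq_of_formJ hK ι hℓ hf hQ'1 hQ'prim hQ'disc
        (hσK g) (hσK g') (hτT g) (hτT g') h2
    apply Subtype.ext
    ext z
    have hz := heq z.2
    rw [hσn g z, hσn g' z] at hz
    exact_mod_cast hz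
  -- surjectivity by counting: `#G_ℓ = ℓ + 1 = #Option (Fin ℓ)`
  have hcard : Nat.card (ringClassGalOver ι (ℓ * f) f) = ℓ + 1 :=
    card_ringClassGalOver_eq_succ hK ι hℓ hinert hℓf hf hunits
  haveI : Finite (ringClassGalOver ι (ℓ * f) f) :=
    Nat.finite_of_card_ne_zero (by rw [hcard]; exact Nat.succ_ne_zero ℓ)
  haveI : Fintype (ringClassGalOver ι (ℓ * f) f) := Fintype.ofFinite _
  refine (Fintype.bijective_iff_injective_and_card i).mpr ⟨hinj, ?_⟩
  rw [Fintype.card_option, Fintype.card_fin, ← Nat.card_eq_fintype_card, hcard]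

end HeegnerTraceOrders

end Literature.NumberTheory.EllipticCurves

end
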